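import Summits.CriticalPhenomena.PercolationContinuityZ3.Theorems.PercNonProliferationSubpolynomialBlockingMeanSpanningOfCrux
import Summits.CriticalPhenomena.PercolationContinuityZ3.Theorems.PercNonProliferationSpanningBKCap
import Literature.Probability.Percolation.ArmEvents
import Literature.Probability.Percolation.SharpnessDCTProofs
import HarnessLib

/-!
# Crux `PercNonProliferation.FreeBoxPowerSaving` (stmt-CriticalPhenomena-4447), line `Sketch_r2_ideator4` (card `onearm-currency-arm-cauchy-schwarz`) — stub `stub_pairGivesOneArm`

Helper file for the crux skeleton `Cruxes/FreeBoxPowerSaving/Lines/Sketch_r2_ideator4.lean`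
(lead prover-line-stmt-CriticalPhenomena-4447-a2-0). Proves exactly the registered stub signature
`stub_pairGivesOneArm` (the "crux ⟹ one-arm decay, modulo r4" half of the line's dictionary); lands
with `--supports stmt-CriticalPhenomena-4447`.

## The statement

Bond percolation `P_p` on `ℤ³`, `B(n) = box 3 n`, `π_p(m) = oneArmProb 3 p m = P_p(0 ↔ ∂ⁱⁿB(m) in B(m))`,
`E_p[N_n] = Σ_{k<|B(n)|} P_p(∃ k+1 points of B(n), each joined inside B(2n) to ∂ⁱⁿB(2n), pairwise not
joined inside B(2n))`, `FA₂ᵖ(n) = |B(n)|⁻² Σ_{x,y∈B(n)} P_p(x ↔ y inside B(n))`,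
`u_n = P_{p_c}(B(n) ↮ ∂ⁱⁿB(2n) inside B(2n))`.  Then

  ASP `(∀ p, ∀ n ≥ 1, π_p(3n)² ≤ 64 · E_p[N_n] · FA₂ᵖ(2n))`
  `→ SubpolynomialBlocking (∀ s > 0, ∀ᶠ n, n^{-s} ≤ u_n)`
  `→ FreeBoxPowerSaving (∃ a > 0, C, ∀ n ≥ 1, FA₂^{p_c}(n) ≤ C n^{-a})`
  `→ ∃ s > 0, C', ∀ m ≥ 1, π_{p_c}(m) ≤ C' m^{-s}`.

## The argument

* With `s := a/2` in r4 and the landed BK cap summed as a geometric series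
  (`SubpolynomialBlocking.meanSpanningSubpoly_of_subpolynomialBlocking spanningBKCap_proof`):
  eventually `E_{p_c}[N_n] ≤ n^{a/2}`; the crux at `2n`: `FA₂(2n) ≤ C (2n)^{-a} = C 2^{-a} n^{-a}`; so ASP
  at `p_c` gives `π(3n)² ≤ 64 C 2^{-a} n^{-a/2}` and `π(3n) ≤ √(64 C 2^{-a}) · n^{-a/4}` for `n ≥ n₀`
  (`PairGivesOneArm.arith`, pure real arithmetic).
* Interpolation (`PairGivesOneArm.oneArmProb_le_of_three_mul`): `m ↦ π(m)` is antitone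
  (`DCT16.real_siteToBoundary_antitone`); for `m ≥ 3n₀` put `n := m/3 ≥ n₀`, `3n ≤ m ≤ 5n`, so
  `π(m) ≤ π(3n) ≤ K n^{-s} ≤ K 5^s m^{-s}`; for `1 ≤ m < 3n₀`, `π(m) ≤ 1 ≤ (3n₀)^s m^{-s}`. Hence
  `π(m) ≤ (K 5^s + (3n₀)^s) m^{-s}` for all `m ≥ 1`, with `s = a/4`.

Tree API: `Theorems.spanningBKCap_proof`,
`Theorems.SubpolynomialBlocking.meanSpanningSubpoly_of_subpolynomialBlocking`,
`DCT16.real_siteToBoundary_antitone`.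
Mathlib: `Real.rpow_le_rpow_of_nonpos`, `Real.mul_rpow`, `Real.rpow_neg`, `Real.rpow_add`, `Real.sq_sqrt`,
`pow_le_pow_iff_left₀`, `Filter.eventually_atTop`, `measureReal_le_one`.
-/

noncomputable section

namespace Summit.CriticalPhenomena.PercolationContinuityZ3.FreeBoxPowerSavingLine

open MeasureTheory Filter
open Literature.Probability.Percolation Literature.Probability.LatticeModels

namespace PairGivesOneArm

/-! ### Real arithmetic at a fixed scale -/

/-- **The arithmetic of one scale `n ≥ 1`.** Reading `π = π_{p_c}(3n)`, `EN = E[N_n]`, `FA = FA₂(2n)`: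
from `π² ≤ 64 · EN · FA`, `EN ≤ n^{a/2}`, `0 ≤ FA ≤ C (2n)^{-a}`, `0 ≤ C`, `0 ≤ π` one gets
`π ≤ √(64 C 2^{-a}) · n^{-a/4}` (since `(2n)^{-a} = 2^{-a} n^{-a}`, `n^{a/2} n^{-a} = n^{-a/2} = (n^{-a/4})²`). -/
theorem arith {π EN FA C a : ℝ} {n : ℕ} (hn : 1 ≤ n) (hπ : 0 ≤ π) (hC : 0 ≤ C)
    (hA : π ^ 2 ≤ 64 * EN * FA) (hEN : EN ≤ (n : ℝ) ^ (a / 2)) (hFA0 : 0 ≤ FA)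
    (hFA : FA ≤ C * ((2 * n : ℕ) : ℝ) ^ (-a)) :
    π ≤ Real.sqrt (64 * C * (2 : ℝ) ^ (-a)) * (n : ℝ) ^ (-(a / 4)) := by
  have hn0 : (0 : ℝ) < n := Nat.cast_pos.2 (Nat.succ_le_iff.1 hn)
  have h2n : ((2 * n : ℕ) : ℝ) ^ (-a) = (2 : ℝ) ^ (-a) * (n : ℝ) ^ (-a) := by
    rw [Nat.cast_mul, Nat.cast_ofNat]
    exact Real.mul_rpow (by norm_num) hn0.le
  have hM0 : 0 ≤ 64 * C * (2 : ℝ) ^ (-a) :=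
    mul_nonneg (mul_nonneg (by norm_num) hC) (Real.rpow_nonneg (by norm_num) _)
  have hcomb : (n : ℝ) ^ (a / 2) * (n : ℝ) ^ (-a) = (n : ℝ) ^ (-(a / 2)) := by
    rw [← Real.rpow_add hn0]
    congr 1
    ring
  have hhalf : ((n : ℝ) ^ (-(a / 4))) ^ 2 = (n : ℝ) ^ (-(a / 2)) := by
    rw [sq, ← Real.rpow_add hn0]
    congr 1
    ring
  have hsq : π ^ 2 ≤ (Real.sqrt (64 * C * (2 : ℝ) ^ (-a)) * (n : ℝ) ^ (-(a / 4))) ^ 2 := by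
    calc π ^ 2 ≤ 64 * EN * FA := hA
      _ = 64 * (EN * FA) := mul_assoc _ _ _
      _ ≤ 64 * ((n : ℝ) ^ (a / 2) * (C * ((2 * n : ℕ) : ℝ) ^ (-a))) :=
          mul_le_mul_of_nonneg_left (mul_le_mul hEN hFA hFA0 (Real.rpow_nonneg hn0.le _))
            (by norm_num)
      _ = 64 * C * (2 : ℝ) ^ (-a) * ((n : ℝ) ^ (a / 2) * (n : ℝ) ^ (-a)) := by
          rw [h2n]
          ring
      _ = (Real.sqrt (64 * C * (2 : ℝ) ^ (-a)) * (n : ℝ) ^ (-(a / 4))) ^ 2 := by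
          rw [hcomb, mul_pow, Real.sq_sqrt hM0, hhalf]
  exact (pow_le_pow_iff_left₀ hπ (mul_nonneg (Real.sqrt_nonneg _) (Real.rpow_nonneg hn0.le _))
    two_ne_zero).1 hsq

/-! ### Interpolation from the scales `3n`, `n ≥ n₀`, to every `m ≥ 1` -/

/-- For `0 ≤ s`, `0 < x ≤ c · y` (`0 < c`): `y^{-s} ≤ c^s · x^{-s}`. -/
theorem rpow_neg_le_of_le_mul {x y c s : ℝ} (hs : 0 ≤ s) (hx : 0 < x) (hc : 0 < c) (hy : 0 < y)
    (hxy : x ≤ c * y) : y ^ (-s) ≤ c ^ s * x ^ (-s) := by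
  have hcc : c ^ s * c ^ (-s) = 1 := by
    rw [Real.rpow_neg hc.le, mul_inv_cancel₀ (Real.rpow_pos_of_pos hc _).ne']
  have hy' : y ^ (-s) = c ^ s * (c * y) ^ (-s) := by
    rw [Real.mul_rpow hc.le hy.le, ← mul_assoc, hcc, one_mul]
  rw [hy']
  exact mul_le_mul_of_nonneg_left (Real.rpow_le_rpow_of_nonpos hx hxy (by linarith))
    (Real.rpow_nonneg hc.le _)

/-- **Interpolation.** If `π_p(3n) ≤ K n^{-s}` for all `n ≥ n₀` (`n₀ ≥ 1`, `K, s ≥ 0`), then for every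
`m ≥ 1`, `π_p(m) ≤ (K · 5^s + (3 n₀)^s) · m^{-s}`: for `m ≥ 3n₀` take `n := m / 3`, so `n ≥ n₀`,
`3n ≤ m ≤ 5n`, and `π_p(m) ≤ π_p(3n)` (`m ↦ π_p(m)` is antitone, `DCT16.real_siteToBoundary_antitone`);
for `m < 3n₀` use `π_p(m) ≤ 1 ≤ (3n₀)^s m^{-s}`. -/
theorem oneArmProb_le_of_three_mul (p : unitInterval) {K s : ℝ} {n₀ : ℕ} (hs : 0 ≤ s) (hK : 0 ≤ K)
    (hn₀ : 1 ≤ n₀) (h : ∀ n : ℕ, n₀ ≤ n → oneArmProb 3 p (3 * n) ≤ K * (n : ℝ) ^ (-s))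
    {m : ℕ} (hm : 1 ≤ m) :
    oneArmProb 3 p m ≤ (K * (5 : ℝ) ^ s + (3 * (n₀ : ℝ)) ^ s) * (m : ℝ) ^ (-s) := by
  have hm0 : (0 : ℝ) < m := Nat.cast_pos.2 (Nat.succ_le_iff.1 hm)
  have hms : 0 ≤ (m : ℝ) ^ (-s) := Real.rpow_nonneg hm0.le _
  have hN0 : (0 : ℝ) < 3 * (n₀ : ℝ) := by
    have : (0 : ℝ) < n₀ := Nat.cast_pos.2 (Nat.succ_le_iff.1 hn₀)
    linarith
  have h5s : 0 ≤ K * (5 : ℝ) ^ s := mul_nonneg hK (Real.rpow_nonneg (by norm_num) _)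
  have hNs : 0 ≤ (3 * (n₀ : ℝ)) ^ s := Real.rpow_nonneg hN0.le _
  rcases le_or_gt (3 * n₀) m with hle | hlt
  · -- large `m`: compare with the scale `3 (m / 3) ≤ m`
    have hn₀n : n₀ ≤ m / 3 := (Nat.le_div_iff_mul_le (by norm_num)).2 (by omega)
    have h3n : 3 * (m / 3) ≤ m := Nat.mul_div_le m 3
    have hn1 : 1 ≤ m / 3 := hn₀.trans hn₀n
    have hn0 : (0 : ℝ) < ((m / 3 : ℕ) : ℝ) := Nat.cast_pos.2 (Nat.succ_le_iff.1 hn1)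
    have hm5 : (m : ℝ) ≤ 5 * ((m / 3 : ℕ) : ℝ) := by
      have : m ≤ 5 * (m / 3) := by omega
      exact_mod_cast this
    calc oneArmProb 3 p m ≤ oneArmProb 3 p (3 * (m / 3)) :=
          DCT16.real_siteToBoundary_antitone p h3n
      _ ≤ K * ((m / 3 : ℕ) : ℝ) ^ (-s) := h (m / 3) hn₀n
      _ ≤ K * ((5 : ℝ) ^ s * (m : ℝ) ^ (-s)) :=
          mul_le_mul_of_nonneg_left (rpow_neg_le_of_le_mul hs hm0 (by norm_num) hn0 hm5) hK
      _ = K * (5 : ℝ) ^ s * (m : ℝ) ^ (-s) := by ring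
      _ ≤ (K * (5 : ℝ) ^ s + (3 * (n₀ : ℝ)) ^ s) * (m : ℝ) ^ (-s) :=
          mul_le_mul_of_nonneg_right (le_add_of_nonneg_right hNs) hms
  · -- small `m`: `π ≤ 1 ≤ (3 n₀)^s m^{-s}`
    have hmN : (m : ℝ) ≤ 3 * (n₀ : ℝ) * 1 := by
      have : m ≤ 3 * n₀ := hlt.le
      rw [mul_one]
      exact_mod_cast this
    calc oneArmProb 3 p m ≤ 1 := measureReal_le_one
      _ = (1 : ℝ) ^ (-s) := (Real.one_rpow _).symm
      _ ≤ (3 * (n₀ : ℝ)) ^ s * (m : ℝ) ^ (-s) := rpow_neg_le_of_le_mul hs hm0 hN0 one_pos hmN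
      _ ≤ (K * (5 : ℝ) ^ s + (3 * (n₀ : ℝ)) ^ s) * (m : ℝ) ^ (-s) :=
          mul_le_mul_of_nonneg_right (le_add_of_nonneg_left h5s) hms

end PairGivesOneArm

open PairGivesOneArm in
/-- **Registered stub `stub_pairGivesOneArm`** (crux stmt-CriticalPhenomena-4447, line `Sketch_r2_ideator4`):
ASP + r4 (`SubpolynomialBlocking`) + the crux (`FreeBoxPowerSaving`) give polynomial ONE-ARM decay at
`p_c(ℤ³)`.  With `s := a/2` in r4 and the summed BK cap (`meanSpanningSubpoly_of_subpolynomialBlocking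
spanningBKCap_proof`): eventually `E[N_n] ≤ n^{a/2}`; the crux at `2n`: `FA₂(2n) ≤ C 2^{-a} n^{-a}`; ASP:
`π(3n)² ≤ 64 C 2^{-a} n^{-a/2}`, so `π(3n) ≤ √(64 C 2^{-a}) n^{-a/4}` for `n ≥ n₀`; then all `m ≥ 1`
by antitonicity of `m ↦ π(m)` and `π ≤ 1` (`PairGivesOneArm.oneArmProb_le_of_three_mul`), with
exponent `a/4`. -/
theorem stub_pairGivesOneArm :
    (∀ (p : unitInterval) (n : ℕ), 1 ≤ n →
      oneArmProb 3 p (3 * n) ^ 2 ≤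
        64 * (∑ k ∈ Finset.range (box 3 n).card, (bondPercolation (zdGraph 3) p).real
          {ω | ∃ x : Fin (k + 1) → Site 3, (∀ i, x i ∈ box 3 n) ∧
            (∀ i, ∃ y ∈ innerBoundary (zdGraph 3) (box 3 (2 * n)),
              ω ∈ openConnIn (↑(box 3 (2 * n)) : Set (Site 3)) (x i) y) ∧
            ∀ i j, i ≠ j → ω ∉ openConnIn (↑(box 3 (2 * n)) : Set (Site 3)) (x i) (x j)}) *
        ((∑ x ∈ box 3 (2 * n), ∑ y ∈ box 3 (2 * n),
            (bondPercolation (zdGraph 3) p).real (openConnIn (↑(box 3 (2 * n)) : Set (Site 3)) x y)) /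
          ((box 3 (2 * n)).card : ℝ) ^ 2)) →
    Summit.CriticalPhenomena.PercolationContinuityZ3.Theses.PercNonProliferation.SubpolynomialBlocking →
    Summit.CriticalPhenomena.PercolationContinuityZ3.Theses.PercNonProliferation.FreeBoxPowerSaving →
      ∃ s C : ℝ, 0 < s ∧ ∀ m : ℕ, 1 ≤ m → oneArmProb 3 (criticalProbI 3) m ≤ C * (m : ℝ) ^ (-s) := by
  intro hASP hSB hFPS
  have hEN := Theorems.SubpolynomialBlocking.meanSpanningSubpoly_of_subpolynomialBlocking
    Theorems.spanningBKCap_proof hSB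
  unfold Summit.CriticalPhenomena.PercolationContinuityZ3.Theses.PercNonProliferation.FreeBoxPowerSaving
    at hFPS
  obtain ⟨a, C, ha, hC⟩ := hFPS
  have hC0 : 0 ≤ C := by
    have h1 := hC 1 le_rfl
    rw [Nat.cast_one, Real.one_rpow, mul_one] at h1
    exact le_trans (by positivity) h1
  -- the bound at the scales `3n`, eventually in `n`
  have key : ∀ᶠ n : ℕ in atTop, oneArmProb 3 (criticalProbI 3) (3 * n) ≤
      Real.sqrt (64 * C * (2 : ℝ) ^ (-a)) * (n : ℝ) ^ (-(a / 4)) := by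
    filter_upwards [hEN (a / 2) (half_pos ha), eventually_ge_atTop 1] with n hENn hn
    exact arith hn measureReal_nonneg hC0 (hASP (criticalProbI 3) n hn) hENn (by positivity)
      (hC (2 * n) (by omega))
  obtain ⟨n₀, hn₀⟩ := eventually_atTop.1 key
  refine ⟨a / 4, Real.sqrt (64 * C * (2 : ℝ) ^ (-a)) * (5 : ℝ) ^ (a / 4) +
    (3 * ((max n₀ 1 : ℕ) : ℝ)) ^ (a / 4), by positivity, fun m hm => ?_⟩
  exact oneArmProb_le_of_three_mul (criticalProbI 3) (by positivity) (Real.sqrt_nonneg _)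
    (le_max_right n₀ 1) (fun n hn => hn₀ n ((le_max_left n₀ 1).trans hn)) hm

end Summit.CriticalPhenomena.PercolationContinuityZ3.FreeBoxPowerSavingLine

end
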